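import Literature.NumberTheory.PAdicHodge.NeronDeRhamDatum
import Summits.BirchSwinnertonDyer.Rank1Residual.GaloisImage.PropagatedStructure
import HarnessLib

/-!
# The scalar dual exponential `exp*_ω` DEFINED on the tree's local integral cohomology
# `H¹(ℚ_v, T_pW) = (tateLocalRep W p (inr v)).cohomology 1` of an elliptic curve `W/ℚ`
# (route `KimAtThreeKolyvagin`, rung W2; cell `bsd-addord`, seat w2-c2 gen 8)

HONEST FRAMING. Definitions with bodies and their proved API (no named fact, no `sorry`, no global
instance, no notation). Nothing is closed and nothing is booked; BSD is not proved by any of this. The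
file SUPPLIES AN OBJECT: the residual packages of the W2 deep leaf — kim3's «defined-Kato package» hK
on crux `stmt-BirchSwinnertonDyer-19560` and w2-c3's (C1ₑₓ) behind cruxes 19075 `DeepLowerAtThree` /
19076 `DeepUpperAtThree` (`KimAtThreeDeepLeafOfDefinedKatoUniform`, p496891) — quantify over an ABSTRACT
additive functional `φ : (tateLocalRep W 3 (Sum.inr v₃)).cohomology 1 →+ ℚ_[3]` «= the scalar dual
exponential `exp*_ω` at `ℚ₃`», about which the two displayed clauses `hker` ([BK90] Prop. 3.8 / Ex. 3.11)
and `hdual` (Tate duality) are stated. With `defn-BlochKatoDualExponential` (p485577) and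
`defn-EllipticNeronDeRhamClass` (p496885, the SCALE-FREE `PeriodRingData.FilZeroLine`) landed, that `φ`
can now be a DEFINED object of exactly that type; this file defines it, so that the (S5) cite items can be
stated about a definition instead of a variable (kim3 g13 HANDOFF «NEXT (i): the SPECIALISATION file»).

## Contents

§1 (any field `F`, any continuous `r : Γ_F → Γ_ℚ`; the curve stays over `ℚ`, as in all W2 files):
* `localTateRep W p r` = `T_pW` restricted along `r` as a continuous `ℤ`-linear representation of `Γ_F`
  — DEFINITIONALLY the tree's `tateLocalRep W p v` at `r = absGaloisRestrict ℚ ℚ_v`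
  (`localTateRep_absGaloisRestrict`, `localTateRep_galRestrictPlace`), and the tower-restricted
  representation of the semi-local consumers at `r ∘ s` (`localTateRep_comp`);
* `localRationalTateRep W p r` = `V_pW` restricted along `r` (`ℚ_p`-linear), with
  `σ • (1 ⊗ a) = 1 ⊗ (r σ • a)` (`localRationalTateRep_toRational`).

§2 (a `p`-adic field `F` in the tree's sense — `IsNonarchimedeanLocalField`, `CharZero`, `Algebra ℚ_[p] F`,
`hp : v(p) < 1` — the exact context of `PAdicHodge.bdRPeriodRingData` / `NeronDeRhamDatum`):
* `LocalNeronLine W hp r := (bdRPeriodRingData hp).FilZeroLine (localRationalTateRep W p r)` — a generator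
  of the `F`-line `D⁰_dR(V_pW|_r)`; `nonempty_localNeronLine_iff_finrank` (existence ⟺ `dim = 1`);
* `pushRational p η` — the push-forward of a continuous crossed homomorphism `η : Γ_F → T_pW` to `V_pW`
  (`TateModule.toRational`, continuous by `TateModule.continuous_toRational`);
* **`expStarOmega hp r d : (localTateRep W p r).cohomology 1 → F`** — Kato's `exp*` (LNM 1553 Ch. II
  1.2.4: `exp* = (∪ log χ_cyclo)⁻¹ ∘ (H¹(F,V) → H¹(F, V ⊗ B_dR⁺))`, the tree's `PeriodRingData.dualExpCoord`
  for `bdRPeriodRingData hp` and `logCyclotomic p`) of the push-forward of ANY representative, read in the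
  coordinate of `d.ω`; representative-independent (`expStarOmega_oneCocycleClass`, via the tree's
  `dualExpCoord_congr_coboundary`); additive under the two halves of Kato's Prop. 1.2.3 — `CupLogInjective`
  and `HasDualExp` for every continuous crossed homomorphism — (`expStarOmega_add`), bundled as
  **`expStarOmegaHom hp r d hinj hex : (localTateRep W p r).cohomology 1 →+ F`**; scale law
  `exp*_{e•ω} = e⁻¹ exp*_ω` and kernel invariance (`expStarOmega_smul`, `expStarOmega_smul_eq_zero_iff`).

§3 = the sequel file `KimAtThreeDeepLowerExpStarOmegaPlace.lean` (`K = ℚ`, a place `v ∣ p`, keyed on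
`[Fact ((p : 𝓞 ℚ) ∈ v.asIdeal)]`): the canonical structures on
`ℚ_v = Place.Completion (inr v)` (definitionally `v.adicCompletion ℚ`) as LOCAL instances — `valuativeRelPlace`,
`topologicalSpacePlace`, `isNonarchimedeanLocalField_place`, `charZero_place` (tree),
`padicAlgebraPlace := LocalField.adicCompletionPadicAlgebra` (the unique continuous `ℚ_p → ℚ_v`),
`valuation_place_lt_one`, `fact_not_isUnit_place`, `isAdicComplete_place` — and, with the restriction
`galRestrictPlace v` named BEFORE them (so that its `ℚ`-algebra structure on `ℚ_v` stays the tree's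
`Place.instAlgebraCompletion` and `localTateRep W p (galRestrictPlace v) = tateLocalRep W p (Sum.inr v)` is
`rfl`): `LocalNeronLineAt W p v`, **`expStarOmegaAt d : (tateLocalRep W p (Sum.inr v)).cohomology 1 → ℚ_v`**,
`expStarOmegaAtHom`, and **`expStarOmegaPadicAt d hinj hex ι : (tateLocalRep W p (Sum.inr v)).cohomology 1 →+ ℚ_[p]`**
for a ring homomorphism `ι : ℚ_v →+* ℚ_[p]` (for `K = ℚ` the unique one, e.g. Mathlib's
`adicCompletion.padicEquiv v`) — EXACTLY the type of the consumers' `φ`; `expStarOmegaPadicAt_eq_zero_iff`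
(the kernel does not see `ι`).

## How the consumers use it (and what is still displayed)

With `φ := expStarOmegaPadicAt d hinj hex ι` (at `p = 3`, `v = v₃`) the clauses `hker` / `hdual` of hK and of
(C1ₑₓ) are statements about a defined map, to be filed as the cite items (S5a) [BlochKato1990, Prop. 3.8,
Ex. 3.11] (`ker exp*_ω = H¹_f = E(ℚ₃) ⊗ ℤ₃`, lattice form) and (S5b) (Tate local duality: `exp*_ω(H¹)` is the
`log_ω`-dual lattice); seat acc5's (DEF) «`Λ 0 r y` has `w`-component `exp*_w(loc_w y)`» reads, at the factor
field `L_w ⊇ ℚ_v`, `expStarOmegaHom hp ((galRestrictPlace v).comp s) d …` (`localTateRep_comp`). Displayed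
and NOT discharged here: the Prop-1.2.3 binders `hinj` / `hex` (Kato's theorem, via Tate's `H^q(K, ℂ_p(i))`),
the existence of the line datum (`Nonempty (LocalNeronLineAt W p v)` ⟺ `dim D⁰_dR(V_pW|_{Γ_{ℚ_v}}) = 1`,
`nonempty_localNeronLine_iff_finrank`; it follows from `PAdicHodge.nonempty_neronDeRhamDatum` for
`W ×_ℚ ℚ_v` once the restriction isomorphism `V_p(W)|_{Γ_{ℚ_v}} ≅ V_p(W ×_ℚ ℚ_v)` of Tate modules is in
the tree — not in this file), and the restriction / corestriction functoriality of `exp*` in the field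
(`DeRhamBaseChange` sequel).

References: K. Kato, LNM 1553 (1993), Ch. II §1.2.2–1.2.4, Prop. 1.2.3, Ex. 1.3.5, §2.1.3 [Kato1993LNM1553];
S. Bloch, K. Kato, *L-functions and Tamagawa numbers of motives* (1990), §3 [BlochKato1990]; K. Kato,
Astérisque 295 (2004), §9.4, Thm. 9.7 [Kato2004Asterisque]; J.-P. Serre, *Abelian ℓ-adic representations*
(1968), I §1–2 [Serre1968]; cell files `KimAtThreeFineKatoLemmaL` (kim3 g13, hker/hdual texts),
`KimAtThreeDeepUpperOfDefinedKatoUniform` / `KimAtThreeDeepLeafOfDefinedKatoUniform` (w2-c3 g7, (C1ₑₓ)),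
`KimAtThreeFineKatoLevelCompatFactor` (acc5 g4, (DEF)/(RES)/(LAT)).
-/

set_option autoImplicit false
-- the Theorems namespace of a single-conjunct summit repeats the summit name by design (D-0017)
set_option linter.dupNamespace false

noncomputable section

open scoped TensorProduct NumberField
open Field ValuativeRel Function IsDedekindDomain
open Literature.NumberTheory.GaloisRepresentations
open Literature.NumberTheory.GaloisRepresentations.PeriodRingData
open Literature.NumberTheory.PAdicHodge
open Literature.NumberTheory.EllipticCurves

namespace Summit.BirchSwinnertonDyer.BirchSwinnertonDyer.Theorems.KimAtThreeDeepLowerExpStarOmega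

/-! ### §1 The local integral and rational Tate representations along `r : Γ_F → Γ_ℚ` -/

section Generic

variable {F : Type} [Field F]
  (W : WeierstrassCurve ℚ) [W.IsElliptic] (p : ℕ) [Fact p.Prime]
  (r : absoluteGaloisGroup F →ₜ* absoluteGaloisGroup ℚ)

/-- **`T_pW|_r`**: the integral Tate module of `W/ℚ` as a continuous `ℤ`-linear representation of
`Γ_F`, restricted along a continuous homomorphism `r : Γ_F → Γ_ℚ` (for `r = absGaloisRestrict ℚ ℚ_v`
this is the tree's `tateLocalRep W p (Sum.inr v)`, `localTateRep_absGaloisRestrict`; for the tower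
`Γ_{L_w} → Γ_{ℚ_v} → Γ_ℚ` it is `(tateLocalRep W p v).restrict _`, `ContinuousRep.restrict_comp`).
[folklore] -/
def localTateRep : ContinuousRep (absoluteGaloisGroup F) ℤ (W.tateModule p) :=
  (W.tateGaloisRep p (W.continuous_galoisRepTate_holds p)).toIntRep.restrict r

/-- **`V_pW|_r`**: the rational Tate module of `W/ℚ` as a continuous `ℚ_p`-linear representation of
`Γ_F` along `r`. [folklore] -/
def localRationalTateRep : ContinuousRep (absoluteGaloisGroup F) ℚ_[p] (W.rationalTateModule p) :=
  (W.rationalTateGaloisRep p (W.continuous_rationalGaloisRepTate_holds p)).restrict r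

omit [W.IsElliptic] in
/-- Unfolding `localTateRep`: `σ` acts through `r σ`. [folklore] -/
@[simp] theorem localTateRep_apply_apply (σ : absoluteGaloisGroup F) (a : W.tateModule p) :
    localTateRep W p r σ a = r σ • a := rfl

/-- Unfolding `localRationalTateRep` on `T_pW → V_pW`: `σ • (1 ⊗ a) = 1 ⊗ (r σ • a)`. [folklore] -/
theorem localRationalTateRep_toRational (σ : absoluteGaloisGroup F) (a : W.tateModule p) :
    localRationalTateRep W p r σ (TateModule.toRational p a) = TateModule.toRational p (r σ • a) :=
  rfl

/-- At a place: `localTateRep W p (absGaloisRestrict ℚ ℚ_v) = tateLocalRep W p v`. [folklore] -/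
theorem localTateRep_absGaloisRestrict (v : NumberField.Place ℚ) :
    localTateRep W p (absGaloisRestrict ℚ (NumberField.Place.Completion v)) =
      Summit.BirchSwinnertonDyer.Rank1Residual.GaloisImage.tateLocalRep W p v := rfl

omit [W.IsElliptic] in
/-- **Towers**: restricting further along `s : Γ_{F'} → Γ_F` is restricting along `r ∘ s` — so for a finite
extension `L_w/ℚ_v` the tower-restricted representation `(tateLocalRep W p (Sum.inr v)).restrict s` of the
semi-local consumers (seat acc5's per-factor COMPAT) is `localTateRep W p (r.comp s)` (`ContinuousRep.restrict_comp`).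
[folklore] -/
theorem localTateRep_comp {F' : Type} [Field F'] (s : absoluteGaloisGroup F' →ₜ* absoluteGaloisGroup F) :
    localTateRep W p (r.comp s) = (localTateRep W p r).restrict s := rfl

/-- The same for `V_pW`. [folklore] -/
theorem localRationalTateRep_comp {F' : Type} [Field F']
    (s : absoluteGaloisGroup F' →ₜ* absoluteGaloisGroup F) :
    localRationalTateRep W p (r.comp s) = (localRationalTateRep W p r).restrict s := rfl

end Generic

/-! ### §2 The scalar dual exponential `exp*_ω` on `H¹(Γ_F, T_pW|_r)` along a local Néron line -/

section ExpStar

variable {F : Type} [Field F] [ValuativeRel F] [TopologicalSpace F] [IsNonarchimedeanLocalField F]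
  [CharZero F] (W : WeierstrassCurve ℚ) [W.IsElliptic] {p : ℕ} [Fact p.Prime]
  [Fact (¬ IsUnit (p : integerC F))] [IsAdicComplete (Ideal.span {(p : integerC F)}) (integerC F)]
  (hp : valuation F p < 1) [Algebra ℚ_[p] F]
  (r : absoluteGaloisGroup F →ₜ* absoluteGaloisGroup ℚ)

/-- **A local Néron line** for `W/ℚ` along `r : Γ_F → Γ_ℚ`: a generator of the `F`-line
`D⁰_dR(V_pW|_r) = Fil⁰((B_dR(F) ⊗ V_pW)^{Γ_F})` — the tree's SCALE-FREE `PeriodRingData.FilZeroLine` of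
`NeronDeRhamDatum.lean` for the period-ring datum `bdRPeriodRingData hp` and the representation
`localRationalTateRep W p r` (the de Rham class of the Néron differential up to `Fˣ`).
[cite: Kato1993LNM1553, Ch. II Ex. 1.3.5 and §2.1.3] -/
abbrev LocalNeronLine :=
  (bdRPeriodRingData (F := F) (p := p) hp).FilZeroLine (localRationalTateRep W p r)

/-- **A local Néron line exists iff `dim_F D⁰_dR(V_pW|_r) = 1`** (the tree's
`FilZeroLine.nonempty_filZeroLine_iff`): the existence of the datum is the printed DIMENSION statement
(Kato Ch. II Ex. 1.3.5 / Fontaine 1982: `D_dR(V_pE)/D⁰_dR ≅ Lie E`, `dim D_dR = 2`), i.e. the content of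
the construction statement `PAdicHodge.nonempty_neronDeRhamDatum` transported from `V_p(W ×_ℚ F)` to
`V_pW|_{Γ_F}` along the restriction isomorphism of Tate modules (torsion points of `W` over `ℚ̄` and over
`F̄` correspond under the tree's `absClosureEmbedding`) — that transport is NOT done in this file.
[cite: Kato1993LNM1553, Ch. II Ex. 1.3.5] -/
theorem nonempty_localNeronLine_iff_finrank :
    Nonempty (LocalNeronLine W hp r) ↔
      Module.finrank F ((bdRPeriodRingData (F := F) (p := p) hp).filD (localRationalTateRep W p r) 0) = 1 :=
  FilZeroLine.nonempty_filZeroLine_iff _ _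

variable {W hp r} (p)

omit [ValuativeRel F] [TopologicalSpace F] [IsNonarchimedeanLocalField F] [CharZero F]
  [Fact (¬ IsUnit (p : integerC F))] [IsAdicComplete (Ideal.span {(p : integerC F)}) (integerC F)]
  [Algebra ℚ_[p] F] in
/-- `T_pW → V_pW` is continuous for the tree's topologies (profinite on `T_pW`, module topology on
`V_pW`; `TateModule.continuous_toRational` with `T_pW` finitely generated over `ℤ_p`,
`module_finite_tateModule_holds`). [folklore] -/
theorem continuous_toRational_tateModule :
    Continuous (TateModule.toRational p : W.tateModule p → W.rationalTateModule p) :=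
  haveI : Module.Finite ℤ_[p] (W.tateModule p) := W.module_finite_tateModule_holds p
  TateModule.continuous_toRational p

/-- **Push-forward of a continuous crossed homomorphism `η : Γ_F → T_pW` to `V_pW`** along
`T_pW → V_pW`, `a ↦ 1 ⊗ a` (continuous, `ℤ_p`-linear, equivariant): a continuous crossed homomorphism of
`V_pW|_r`. [folklore] -/
def pushRational (η : contOneCocycles (localTateRep W p r).toTopRep) :
    contOneCocycles (localRationalTateRep W p r).toTopRep :=
  ⟨⟨fun g => TateModule.toRational p (η.1 g),
      (continuous_toRational_tateModule (W := W) p).comp η.1.continuous⟩,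
    fun g h => by
      change TateModule.toRational p (η.1 (g * h)) =
        TateModule.toRational p (η.1 g) + localRationalTateRep W p r g (TateModule.toRational p (η.1 h))
      rw [η.2 g h]
      change TateModule.toRational p (η.1 g + r g • η.1 h) = _
      rw [map_add, localRationalTateRep_toRational]⟩

omit [ValuativeRel F] [IsNonarchimedeanLocalField F] [CharZero F]
  [Fact (¬ IsUnit (p : integerC F))] [IsAdicComplete (Ideal.span {(p : integerC F)}) (integerC F)]
  [Algebra ℚ_[p] F] [TopologicalSpace F] in
/-- Unfolding `pushRational`. [folklore] -/
@[simp] theorem pushRational_apply (η : contOneCocycles (localTateRep W p r).toTopRep)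
    (g : absoluteGaloisGroup F) : (pushRational p η).1 g = TateModule.toRational p (η.1 g) := rfl

omit [ValuativeRel F] [TopologicalSpace F] [IsNonarchimedeanLocalField F] [CharZero F]
  [Fact (¬ IsUnit (p : integerC F))] [IsAdicComplete (Ideal.span {(p : integerC F)}) (integerC F)]
  [Algebra ℚ_[p] F] in
/-- The push-forward to `V_pW` is additive on crossed homomorphisms (pointwise). [folklore] -/
theorem pushRational_add_apply (η η' : contOneCocycles (localTateRep W p r).toTopRep)
    (g : absoluteGaloisGroup F) :
    (pushRational p (η + η')).1 g = (pushRational p η).1 g + (pushRational p η').1 g := by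
  have h : (η + η').1 g = η.1 g + η'.1 g := rfl
  rw [pushRational_apply, pushRational_apply, pushRational_apply, h, map_add]

variable {p} (hp r)

/-- **`exp*_ω : H¹(Γ_F, T_pW|_r) → F`**, the scalar dual exponential of Kato (LNM 1553 Ch. II 1.2.4,
`exp* = ᵗ(∪ log χ_cyclo)⁻¹`) read in the coordinate of a local Néron line `d` (`exp* y = exp*_ω(y) · ω`),
on the tree's `ℤ`-linear continuous cohomology `ContinuousRep.cohomology` of the integral local
representation: the tree's `PeriodRingData.dualExpCoord` of the `V_pW`-valued push-forward of ANY
continuous crossed homomorphism representing the class (choice-free up to `dualExpCoord_congr_coboundary`,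
see `expStarOmega_oneCocycleClass`). This is the `φ = exp*_ω` of the W2 residual packages (kim3's hK,
w2-c3's (C1ₑₓ)) for `F = ℚ₃`. [cite: Kato1993LNM1553, Ch. II §1.2.4 and Ex. 1.3.5] -/
def expStarOmega (d : LocalNeronLine W hp r) (y : (localTateRep W p r).cohomology 1) : F :=
  (bdRPeriodRingData hp).dualExpCoord (logCyclotomic p) (localRationalTateRep W p r) d.ω
    fun σ => TateModule.toRational p
      ((surjInv (oneCocycleClass_surjective (localTateRep W p r).toTopRep) y).1 σ)

/-- **`exp*_ω [η] = exp*_ω(1 ⊗ η)`**: the value on the class of a continuous crossed homomorphism `η`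
is the coordinate of Kato's `exp*` of its push-forward to `V_pW` — independent of the representative
(two representatives differ by `σ ↦ σ a - a`, whose push-forward is a principal crossed homomorphism
of `V_pW`; `dualExpCoord_congr_coboundary`). [cite: Kato1993LNM1553, Ch. II §1.2.4] -/
theorem expStarOmega_oneCocycleClass (d : LocalNeronLine W hp r)
    (η : contOneCocycles (localTateRep W p r).toTopRep) :
    expStarOmega hp r d (oneCocycleClass _ η) =
      (bdRPeriodRingData hp).dualExpCoord (logCyclotomic p) (localRationalTateRep W p r) d.ω
        fun σ => (pushRational p η).1 σ := by
  unfold expStarOmega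
  set η' := surjInv (oneCocycleClass_surjective (localTateRep W p r).toTopRep) (oneCocycleClass _ η)
    with hη'
  have hcl : oneCocycleClass _ η' = oneCocycleClass _ η :=
    surjInv_eq (oneCocycleClass_surjective (localTateRep W p r).toTopRep) _
  have h0 : oneCocycleClass _ (η' - η) = 0 := by rw [oneCocycleClass_sub, hcl, sub_self]
  obtain ⟨a, ha⟩ := (oneCocycleClass_eq_zero_iff _ _).1 h0
  refine dualExpCoord_congr_coboundary (TateModule.toRational p a) fun σ => ?_
  have hσ : η'.1 σ = η.1 σ + (r σ • a - a) := by
    have h := ha σ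
    change η'.1 σ - η.1 σ = r σ • a - a at h
    rw [← h]; abel
  change TateModule.toRational p (η'.1 σ) = TateModule.toRational p (η.1 σ) +
    (localRationalTateRep W p r σ (TateModule.toRational p a) - TateModule.toRational p a)
  rw [hσ, map_add, map_sub, localRationalTateRep_toRational]

/-- **`exp*_ω` is additive** on `H¹(Γ_F, T_pW|_r)`, under the two halves of Kato's Prop. 1.2.3 for
`V_pW|_r` — injectivity of `x ↦ x ∪ log χ_cyclo` on `D⁰_dR` (`CupLogInjective`) and existence of a dual
exponential for every continuous crossed homomorphism (`HasDualExp`) — the binders under which the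
tree's `dualExpCoord_add` is stated (to be discharged by the Prop-1.2.3 cite item for the de Rham
representation `V_pW`). [cite: Kato1993LNM1553, Ch. II Prop. 1.2.3 and §1.2.4] -/
theorem expStarOmega_add (d : LocalNeronLine W hp r)
    (hinj : (bdRPeriodRingData hp).CupLogInjective (logCyclotomic p) (localRationalTateRep W p r))
    (hex : ∀ z : contOneCocycles (localRationalTateRep W p r).toTopRep,
      (bdRPeriodRingData hp).HasDualExp (logCyclotomic p) (localRationalTateRep W p r) fun σ => z.1 σ)
    (y y' : (localTateRep W p r).cohomology 1) :
    expStarOmega hp r d (y + y') = expStarOmega hp r d y + expStarOmega hp r d y' := by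
  obtain ⟨η, rfl⟩ := oneCocycleClass_surjective _ y
  obtain ⟨η', rfl⟩ := oneCocycleClass_surjective _ y'
  have h : (fun σ => (pushRational p (η + η')).1 σ) =
      fun σ => (pushRational p η).1 σ + (pushRational p η').1 σ :=
    funext (pushRational_add_apply p η η')
  have key : expStarOmega hp r d (oneCocycleClass _ (η + η')) =
      expStarOmega hp r d (oneCocycleClass _ η) + expStarOmega hp r d (oneCocycleClass _ η') := by
    rw [expStarOmega_oneCocycleClass, expStarOmega_oneCocycleClass, expStarOmega_oneCocycleClass, h]
    exact dualExpCoord_add hinj d.ne_zero d.exists_smul_eq (hex _) (hex _)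
  -- the sum of classes is the class of the sum (`ContinuousRep.cohomology` is Mathlib's
  -- `continuousCohomology` with the same additive structure, `inferInstanceAs`)
  rw [← key]
  congr 1
  exact (oneCocycleClass_add (localTateRep W p r).toTopRep η η').symm

/-- **`exp*_ω` as an additive map `H¹(Γ_F, T_pW|_r) →+ F`** (under the Prop-1.2.3 binders). This is
the TYPE of the abstract functional `φ` of the W2 residual packages once `F = ℚ_v` is identified with
`ℚ_p` (`expStarOmegaPadic`). [cite: Kato1993LNM1553, Ch. II §1.2.4 and Prop. 1.2.3] -/
def expStarOmegaHom (d : LocalNeronLine W hp r)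
    (hinj : (bdRPeriodRingData hp).CupLogInjective (logCyclotomic p) (localRationalTateRep W p r))
    (hex : ∀ z : contOneCocycles (localRationalTateRep W p r).toTopRep,
      (bdRPeriodRingData hp).HasDualExp (logCyclotomic p) (localRationalTateRep W p r) fun σ => z.1 σ) :
    (localTateRep W p r).cohomology 1 →+ F :=
  AddMonoidHom.mk' (expStarOmega hp r d) (expStarOmega_add hp r d hinj hex)

/-- Unfolding `expStarOmegaHom`. [cite: Kato1993LNM1553, Ch. II §1.2.4] -/
@[simp] theorem expStarOmegaHom_apply (d : LocalNeronLine W hp r)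
    (hinj : (bdRPeriodRingData hp).CupLogInjective (logCyclotomic p) (localRationalTateRep W p r))
    (hex : ∀ z : contOneCocycles (localRationalTateRep W p r).toTopRep,
      (bdRPeriodRingData hp).HasDualExp (logCyclotomic p) (localRationalTateRep W p r) fun σ => z.1 σ)
    (y : (localTateRep W p r).cohomology 1) :
    expStarOmegaHom hp r d hinj hex y = expStarOmega hp r d y := rfl

/-- **Scale law `exp*_{e•ω} = e⁻¹ · exp*_ω`** (`e ≠ 0`): changing the generator of the Néron line
rescales the functional by a unit of `F` — every statement of the consumers about `exp*_ω` is either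
scale-invariant (its kernel) or quantifies over the line datum. [cite: Kato1993LNM1553, Ch. II §1.2.4 and Ex. 1.3.5] -/
theorem expStarOmega_smul (d : LocalNeronLine W hp r) {e : F} (he : e ≠ 0)
    (y : (localTateRep W p r).cohomology 1) :
    expStarOmega hp r (d.smul e he) y = e⁻¹ * expStarOmega hp r d y :=
  d.dualExpCoord_smul he _

/-- The kernel of `exp*_ω` does not depend on the generator. [cite: Kato1993LNM1553, Ch. II §1.2.4] -/
theorem expStarOmega_smul_eq_zero_iff (d : LocalNeronLine W hp r) {e : F} (he : e ≠ 0)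
    (y : (localTateRep W p r).cohomology 1) :
    expStarOmega hp r (d.smul e he) y = 0 ↔ expStarOmega hp r d y = 0 := by
  rw [expStarOmega_smul, mul_eq_zero, or_iff_right (inv_ne_zero he)]

end ExpStar



end Summit.BirchSwinnertonDyer.BirchSwinnertonDyer.Theorems.KimAtThreeDeepLowerExpStarOmega

end
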